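import Mathlib.MeasureTheory.Integral.DominatedConvergence
import Mathlib.Analysis.SpecialFunctions.Integrals.Basic
import Mathlib.Analysis.SpecialFunctions.Integrability.Basic
import Mathlib.Topology.ContinuousMap.Compact
import HarnessLib

/-!
# The weakly singular Duhamel operator `G ↦ (t ↦ ∫₀ᵗ K(t − s) G(s) ds)` on `C([0, τ]; E)`

Analysis/UnboundedOperators support file (theorems only, everything proved, no named facts, no
definitions).  Let `E`, `F` be real normed spaces and `K : (0, ∞) → L(E, F)` a family of bounded
operators which is

* **weakly singular at `t = 0`**: `‖K(t)‖ ≤ C t^{-α}` for `t > 0`, with `α < 1` (so `t ↦ ‖K(t)‖` is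
  integrable at `0`), and
* **strongly continuous** on `(0, ∞)`: `t ↦ K(t) y` is continuous on `(0, ∞)` for every `y`.

The model is `K(t) = A^α e^{-tA}` for a sectorial operator `A` (Henry 1981, Thm 1.4.3:
`‖A^α e^{-At}‖ ≤ C_α t^{-α} e^{-δt}`; Pazy 1983, Thm 2.6.13 (c)), the kernel of the Duhamel term of a
semilinear parabolic equation `u' + Au = f(t, u)` read in the fractional-power space `X^α`.  For a
continuous `g : ℝ → E` we study the weakly singular convolution

  `Ψ(t) = ∫₀ᵗ K(t − s) g(s) ds`   (interval Bochner integral `∫ s in 0..t`).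

Main results (Pazy 1983, §6.3, proof of Thm 3.1, the map `F` of (3.7) and the estimates (3.8)–(3.9):
"Clearly, `F : Y → Y`" for `Y = C([t₀, t₁] : X)` and
`‖Fy₁(t) − Fy₂(t)‖ ≤ L C_α (1 − α)^{-1} (t₁ − t₀)^{1−α} ‖y₁ − y₂‖_Y`; Henry 1981, Lemma 3.3.2 and the
proof of Thm 3.3.3):

* `continuousOn_apply_of_norm_le_rpow` — `u ↦ K(u) v(u)` is continuous on `(0, ∞)` for continuous `v`
  (strong continuity + the locally bounded operator norm);
* `intervalIntegrable_duhamelIntegrand` — `s ↦ K(t − s) g(s)` is integrable on `[0, t]`;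
* `norm_integral_duhamel_le` — **the weakly singular bound**
  `‖∫₀ᵗ K(t − s) g(s) ds‖ ≤ C t^{1−α} (1 − α)^{-1} · sup ‖g‖`, and `… ≤ C τ^{1−α} (1 − α)^{-1} sup ‖g‖`
  for `t ∈ [0, τ]` (`norm_integral_duhamel_le_of_mem_Icc`);
* `continuousOn_integral_duhamel` — `t ↦ ∫₀ᵗ K(t − s) g(s) ds` is continuous on `[0, ∞)` (after the
  substitution `u = t − s` the integrand `K(u) g(t − u)` is continuous in `t` for every fixed `u > 0` and
  dominated by the integrable `C u^{-α} sup ‖g‖`, so Mathlib's dominated-convergence lemma for parametric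
  primitives `intervalIntegral.continuousAt_parametric_primitive_of_dominated` applies);
* `integral_duhamel_add`, `integral_duhamel_smul` — linearity in `g`;
* `exists_duhamelCLM` — **the Duhamel operator** `Φ : C([0, τ]; E) →L[ℝ] C([0, τ]; E)`,
  `(Φ G)(t) = ∫₀ᵗ K(t − s) G(s) ds` (with `G` extended to `ℝ` by constants through `Set.projIcc`), of
  operator norm `‖Φ‖ ≤ C τ^{1−α} / (1 − α)`.

This is the linear brick of the mild (variation-of-constants) Picard map
`y ↦ e^{-tA} y₀ + ∫₀ᵗ A^α e^{-(t−s)A} N(y(s)) ds` on `C([0, τ]; E)` whose fixed points are the local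
strong solutions of semilinear parabolic equations (Pazy 1983 Thm 6.3.1, Henry 1981 Thm 3.3.3,
Fujita–Kato 1964 for Navier–Stokes).  Deliberately NOT here: the semigroup property of `K`, Hölder
regularity in `t` (Pazy (3.12)–(3.16)), differentiability of the fixed point in the data.

## References

* A. Pazy, *Semigroups of Linear Operators and Applications to Partial Differential Equations*,
  Springer (1983), §6.3, Thm 3.1 and its proof, (3.3), (3.7)–(3.9); Thm 2.6.13 (c). [Pazy1983]
* D. Henry, *Geometric Theory of Semilinear Parabolic Equations*, LNM 840 (1981), Thm 1.4.3,
  Lemma 3.3.2, Thm 3.3.3. [Henry1981]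
-/

open MeasureTheory Set Filter Topology intervalIntegral

namespace Literature.Analysis.UnboundedOperators

variable {E F : Type*} [NormedAddCommGroup E] [NormedSpace ℝ E] [NormedAddCommGroup F]
  [NormedSpace ℝ F]

/-! ### Strongly continuous, weakly singular operator families applied to continuous vectors -/

/-- **Joint continuity from strong continuity and a local norm bound.**  If `‖K(t)‖ ≤ C t^{-α}` on
`(0, ∞)` and `t ↦ K(t) y` is continuous on `(0, ∞)` for every `y`, then `u ↦ K(u) v(u)` is continuous
on `(0, ∞)` for every continuous `v` (write `K(u)v(u) − K(u₀)v(u₀) = K(u)(v(u) − v(u₀)) + (K(u) − K(u₀))v(u₀)`;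
the first term is `≤ C u^{-α} ‖v(u) − v(u₀)‖ → 0`). [folklore] -/
theorem continuousOn_apply_of_norm_le_rpow {α C : ℝ} {K : ℝ → E →L[ℝ] F}
    (hK : ∀ t, 0 < t → ‖K t‖ ≤ C * t ^ (-α))
    (hKc : ∀ y : E, ContinuousOn (fun t : ℝ => K t y) (Ioi 0)) {v : ℝ → E} (hv : Continuous v) :
    ContinuousOn (fun u => K u (v u)) (Ioi 0) := by
  intro u₀ hu₀
  have hu₀' : (0 : ℝ) < u₀ := hu₀
  have h1 : Tendsto (fun u => K u (v u) - K u (v u₀)) (𝓝[Ioi 0] u₀) (𝓝 0) := by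
    refine squeeze_zero_norm' (a := fun u => C * u ^ (-α) * ‖v u - v u₀‖) ?_ ?_
    · filter_upwards [self_mem_nhdsWithin] with u hu
      rw [← ContinuousLinearMap.map_sub]
      exact (K u).le_of_opNorm_le (hK u hu) _
    · have h2 : Tendsto (fun u => C * u ^ (-α) * ‖v u - v u₀‖) (𝓝 u₀)
          (𝓝 (C * u₀ ^ (-α) * ‖v u₀ - v u₀‖)) :=
        (tendsto_const_nhds.mul
          (Real.continuousAt_rpow_const _ _ (Or.inl hu₀'.ne')).tendsto).mul
          (((hv.tendsto u₀).sub tendsto_const_nhds).norm)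
      rw [sub_self, norm_zero, mul_zero] at h2
      exact h2.mono_left nhdsWithin_le_nhds
  have h3 : Tendsto (fun u => K u (v u₀)) (𝓝[Ioi 0] u₀) (𝓝 (K u₀ (v u₀))) := hKc (v u₀) u₀ hu₀
  have h4 := h1.add h3
  simp only [sub_add_cancel, zero_add] at h4
  exact h4

/-- The Duhamel integrand `s ↦ K(t − s) g(s)` of a continuous `g` is continuous on `(-∞, t)`.
[folklore] -/
theorem continuousOn_duhamelIntegrand {α C : ℝ} {K : ℝ → E →L[ℝ] F}
    (hK : ∀ t, 0 < t → ‖K t‖ ≤ C * t ^ (-α))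
    (hKc : ∀ y : E, ContinuousOn (fun t : ℝ => K t y) (Ioi 0)) {g : ℝ → E} (hg : Continuous g)
    (t : ℝ) : ContinuousOn (fun s => K (t - s) (g s)) (Iio t) := by
  have h := continuousOn_apply_of_norm_le_rpow hK hKc (hg.comp' (continuous_sub_left t))
  refine (h.comp (continuous_sub_left t).continuousOn fun s hs => ?_).congr fun s _ => ?_
  · exact mem_Ioi.2 (sub_pos.2 (mem_Iio.1 hs))
  · simp only [Function.comp_apply, sub_sub_cancel]

/-- The weakly singular pointwise bound `‖K(t − s) g(s)‖ ≤ C (t − s)^{-α} ‖g(s)‖` for `s < t`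
(Pazy 1983, §6.3 (3.3)). [folklore] -/
theorem norm_duhamelIntegrand_le {α C : ℝ} {K : ℝ → E →L[ℝ] F}
    (hK : ∀ t, 0 < t → ‖K t‖ ≤ C * t ^ (-α)) (g : ℝ → E) {t s : ℝ} (hs : s < t) :
    ‖K (t - s) (g s)‖ ≤ C * (t - s) ^ (-α) * ‖g s‖ :=
  (K (t - s)).le_of_opNorm_le (hK _ (sub_pos.2 hs)) _

/-! ### The scalar majorant `C (t − s)^{-α}` -/

/-- `s ↦ (t − s)^{-α}` is integrable on `[0, t]` for `α < 1`. [folklore] -/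
theorem intervalIntegrable_sub_rpow_neg {α : ℝ} (hα : α < 1) (t : ℝ) :
    IntervalIntegrable (fun s => (t - s) ^ (-α)) volume 0 t := by
  have h := (intervalIntegral.intervalIntegrable_rpow' (a := 0) (b := t)
    (by linarith : (-1 : ℝ) < -α)).comp_sub_left t
  simp only [sub_zero, sub_self] at h
  exact h.symm

/-- `∫₀ᵗ (t − s)^{-α} ds = t^{1−α} / (1 − α)` for `α < 1` (Pazy 1983, proof of Thm 6.3.1:
"`C_α (Lδ + B) ∫_{t₀}^t (t − s)^{-α} ds = C_α (1 − α)^{-1} (Lδ + B)(t₁ − t₀)^{1−α}`"). [folklore] -/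
theorem integral_sub_rpow_neg {α : ℝ} (hα : α < 1) (t : ℝ) :
    ∫ s in (0 : ℝ)..t, (t - s) ^ (-α) = t ^ (1 - α) / (1 - α) := by
  rw [intervalIntegral.integral_comp_sub_left (fun u => u ^ (-α)) t, sub_self, sub_zero,
    integral_rpow (Or.inl (by linarith)), Real.zero_rpow (by linarith), sub_zero, neg_add_eq_sub]

omit [NormedSpace ℝ E] in
/-- The majorant `s ↦ C (t − s)^{-α} ‖g(s)‖` of the Duhamel integrand is integrable on `[0, t]`.
[folklore] -/
theorem intervalIntegrable_const_mul_sub_rpow_neg_mul_norm {α : ℝ} (hα : α < 1) (C : ℝ)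
    {g : ℝ → E} (hg : Continuous g) (t : ℝ) :
    IntervalIntegrable (fun s => C * (t - s) ^ (-α) * ‖g s‖) volume 0 t :=
  ((intervalIntegrable_sub_rpow_neg hα t).const_mul C).mul_continuousOn hg.norm.continuousOn

/-! ### Integrability, bound, continuity and linearity of `t ↦ ∫₀ᵗ K(t − s) g(s) ds` -/

/-- **Integrability of the Duhamel integrand**: for `α < 1`, continuous `g` and `t ≥ 0`,
`s ↦ K(t − s) g(s)` is integrable on `[0, t]` (continuous on `[0, t)` and dominated by the integrable
`C (t − s)^{-α} ‖g(s)‖`). [cite: Pazy1983, §6.3, proof of Thm 3.1, (3.7)] -/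
theorem intervalIntegrable_duhamelIntegrand {α C : ℝ} {K : ℝ → E →L[ℝ] F}
    (hK : ∀ t, 0 < t → ‖K t‖ ≤ C * t ^ (-α))
    (hKc : ∀ y : E, ContinuousOn (fun t : ℝ => K t y) (Ioi 0)) (hα : α < 1) {g : ℝ → E}
    (hg : Continuous g) {t : ℝ} (ht : 0 ≤ t) :
    IntervalIntegrable (fun s => K (t - s) (g s)) volume 0 t := by
  refine (intervalIntegrable_const_mul_sub_rpow_neg_mul_norm hα C hg t).mono_fun' ?_ ?_
  · rw [uIoc_of_le ht, ← Measure.restrict_congr_set Ioo_ae_eq_Ioc]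
    exact ((continuousOn_duhamelIntegrand hK hKc hg t).mono
      Ioo_subset_Iio_self).aestronglyMeasurable measurableSet_Ioo
  · rw [uIoc_of_le ht, ← Measure.restrict_congr_set Ioo_ae_eq_Ioc]
    exact ae_restrict_of_forall_mem measurableSet_Ioo fun s hs => norm_duhamelIntegrand_le hK g hs.2

/-- **The weakly singular bound** (Pazy 1983, proof of Thm 6.3.1, (3.8)–(3.9); Henry 1981, proof of
Thm 3.3.3): if `‖g(s)‖ ≤ M` for all `s`, then for `t ≥ 0`
`‖∫₀ᵗ K(t − s) g(s) ds‖ ≤ ∫₀ᵗ C (t − s)^{-α} M ds = C t^{1−α} (1 − α)^{-1} M`.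
[cite: Pazy1983, §6.3, proof of Thm 3.1, (3.9)] -/
theorem norm_integral_duhamel_le {α C : ℝ} {K : ℝ → E →L[ℝ] F}
    (hK : ∀ t, 0 < t → ‖K t‖ ≤ C * t ^ (-α)) (hC : 0 ≤ C) (hα : α < 1) (g : ℝ → E) {M : ℝ}
    (hM : ∀ s, ‖g s‖ ≤ M) {t : ℝ} (ht : 0 ≤ t) :
    ‖∫ s in (0 : ℝ)..t, K (t - s) (g s)‖ ≤ C * t ^ (1 - α) / (1 - α) * M := by
  calc ‖∫ s in (0 : ℝ)..t, K (t - s) (g s)‖ ≤ ∫ s in (0 : ℝ)..t, C * (t - s) ^ (-α) * M := by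
        refine intervalIntegral.norm_integral_le_of_norm_le ht ?_
          (((intervalIntegrable_sub_rpow_neg hα t).const_mul C).mul_const M)
        filter_upwards [compl_mem_ae_iff.mpr (Real.volume_singleton (a := t))] with s hst hs
        have hst' : s < t := lt_of_le_of_ne hs.2 hst
        calc ‖K (t - s) (g s)‖ ≤ C * (t - s) ^ (-α) * ‖g s‖ := norm_duhamelIntegrand_le hK g hst'
          _ ≤ C * (t - s) ^ (-α) * M :=
            mul_le_mul_of_nonneg_left (hM s)
              (mul_nonneg hC (Real.rpow_nonneg (sub_pos.2 hst').le _))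
    _ = C * (t ^ (1 - α) / (1 - α)) * M := by
        rw [intervalIntegral.integral_mul_const, intervalIntegral.integral_const_mul,
          integral_sub_rpow_neg hα]
    _ = C * t ^ (1 - α) / (1 - α) * M := by ring

/-- The weakly singular bound on a compact time interval: for `t ∈ [0, τ]`,
`‖∫₀ᵗ K(t − s) g(s) ds‖ ≤ C τ^{1−α} (1 − α)^{-1} M` (Pazy 1983, proof of Thm 6.3.1, (3.9):
"`≤ L C_α (1 − α)^{-1} (t₁ − t₀)^{1−α} ‖y₁ − y₂‖_Y`"). [cite: Pazy1983, §6.3, proof of Thm 3.1, (3.9)] -/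
theorem norm_integral_duhamel_le_of_mem_Icc {α C : ℝ} {K : ℝ → E →L[ℝ] F}
    (hK : ∀ t, 0 < t → ‖K t‖ ≤ C * t ^ (-α)) (hC : 0 ≤ C) (hα : α < 1) (g : ℝ → E) {M : ℝ}
    (hM : ∀ s, ‖g s‖ ≤ M) {τ t : ℝ} (ht : t ∈ Icc 0 τ) :
    ‖∫ s in (0 : ℝ)..t, K (t - s) (g s)‖ ≤ C * τ ^ (1 - α) / (1 - α) * M := by
  refine (norm_integral_duhamel_le hK hC hα g hM ht.1).trans ?_
  have hM0 : 0 ≤ M := (norm_nonneg _).trans (hM 0)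
  have h1α : 0 < 1 - α := sub_pos.2 hα
  have h1 : t ^ (1 - α) ≤ τ ^ (1 - α) := Real.rpow_le_rpow ht.1 ht.2 h1α.le
  have h2 : C * t ^ (1 - α) / (1 - α) ≤ C * τ ^ (1 - α) / (1 - α) :=
    div_le_div_of_nonneg_right (mul_le_mul_of_nonneg_left h1 hC) h1α.le
  exact mul_le_mul_of_nonneg_right h2 hM0

/-- **Continuity of the weakly singular convolution** (Pazy 1983, proof of Thm 6.3.1: "Clearly,
`F : Y → Y`", `Y = C([t₀, t₁] : X)`; Henry 1981, Lemma 3.3.2): for continuous bounded `g`,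
`t ↦ ∫₀ᵗ K(t − s) g(s) ds` is continuous on `[0, ∞)`.  Proof: `∫₀ᵗ K(t − s) g(s) ds = ∫₀ᵗ K(u) g(t − u) du`,
and `(t, u) ↦ 𝟙_{u > 0} K(u) g(t − u)` is continuous in `t` for every `u`, measurable in `u`, and
dominated by the integrable `𝟙_{u > 0} C u^{-α} sup‖g‖`, so the parametric primitive is jointly
continuous (`intervalIntegral.continuousAt_parametric_primitive_of_dominated`).
[cite: Pazy1983, §6.3, proof of Thm 3.1, (3.7)] -/
theorem continuousOn_integral_duhamel {α C : ℝ} {K : ℝ → E →L[ℝ] F}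
    (hK : ∀ t, 0 < t → ‖K t‖ ≤ C * t ^ (-α))
    (hKc : ∀ y : E, ContinuousOn (fun t : ℝ => K t y) (Ioi 0)) (hC : 0 ≤ C) (hα : α < 1)
    {g : ℝ → E} (hg : Continuous g) {M : ℝ} (hM : ∀ s, ‖g s‖ ≤ M) :
    ContinuousOn (fun t => ∫ s in (0 : ℝ)..t, K (t - s) (g s)) (Ici 0) := by
  intro t₀ ht₀
  have ht₀' : (0 : ℝ) ≤ t₀ := ht₀
  -- the integrand after the substitution `u = t - s`, cut off at `u ≤ 0`
  set Φ : ℝ → ℝ → F := fun x u => (Ioi (0 : ℝ)).indicator (fun u => K u (g (x - u))) u with hΦ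
  have hcu : ∀ x, ContinuousOn (fun u => K u (g (x - u))) (Ioi 0) := fun x =>
    continuousOn_apply_of_norm_le_rpow hK hKc (hg.comp' (continuous_sub_left x))
  have key : ContinuousAt (fun p : ℝ × ℝ => ∫ u in (0 : ℝ)..p.2, Φ p.1 u) (t₀, t₀) := by
    refine intervalIntegral.continuousAt_parametric_primitive_of_dominated (μ := volume)
      (fun u => (Ioi (0 : ℝ)).indicator (fun u => C * u ^ (-α) * M) u) (-1) (t₀ + 1)
      (fun x => ?_) ?_ ?_ ?_ ⟨by linarith, by linarith⟩ ⟨by linarith, by linarith⟩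
      Real.volume_singleton
    · rw [hΦ, aestronglyMeasurable_indicator_iff measurableSet_Ioi,
        Measure.restrict_restrict measurableSet_Ioi]
      exact ((hcu x).mono inter_subset_left).aestronglyMeasurable
        (measurableSet_Ioi.inter measurableSet_uIoc)
    · refine Eventually.of_forall fun x => ae_of_all _ fun u => ?_
      by_cases hu : u ∈ Ioi (0 : ℝ)
      · simp only [hΦ, indicator_of_mem hu]
        calc ‖K u (g (x - u))‖ ≤ C * u ^ (-α) * ‖g (x - u)‖ := (K u).le_of_opNorm_le (hK u hu) _
          _ ≤ C * u ^ (-α) * M :=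
            mul_le_mul_of_nonneg_left (hM _) (mul_nonneg hC (Real.rpow_nonneg (le_of_lt hu) _))
      · simp only [hΦ, indicator_of_notMem hu, norm_zero, le_refl]
    · have h := ((intervalIntegral.intervalIntegrable_rpow' (a := -1) (b := t₀ + 1)
        (by linarith : (-1 : ℝ) < -α)).const_mul C).mul_const M
      exact ⟨h.1.indicator measurableSet_Ioi, h.2.indicator measurableSet_Ioi⟩
    · refine ae_of_all _ fun u => ?_
      by_cases hu : u ∈ Ioi (0 : ℝ)
      · simp only [hΦ, indicator_of_mem hu]
        exact ((K u).continuous.comp' (hg.comp' (continuous_sub_right u))).continuousAt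
      · simp only [hΦ, indicator_of_notMem hu]
        exact continuousAt_const
  have key' : ContinuousAt (fun t : ℝ => ∫ u in (0 : ℝ)..t, Φ t u) t₀ :=
    key.comp' (f := fun t : ℝ => (t, t)) (continuousAt_id.prodMk continuousAt_id)
  -- undo the substitution on `[0, ∞)`
  have heq : ∀ t ∈ Ici (0 : ℝ), ∫ s in (0 : ℝ)..t, K (t - s) (g s) = ∫ u in (0 : ℝ)..t, Φ t u := by
    intro t ht
    have ht' : (0 : ℝ) ≤ t := ht
    have h := intervalIntegral.integral_comp_sub_left (fun u => K u (g (t - u))) t (a := 0) (b := t)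
    simp only [sub_sub_cancel, sub_self, sub_zero] at h
    rw [h]
    refine intervalIntegral.integral_congr_ae (ae_of_all _ fun u hu => ?_)
    rw [uIoc_of_le ht'] at hu
    simp only [hΦ, indicator_of_mem (show u ∈ Ioi (0 : ℝ) from hu.1)]
  exact key'.continuousWithinAt.congr (fun t ht => heq t ht) (heq t₀ ht₀)

/-- Additivity of the Duhamel integral in `g` (for `t ≥ 0`, where both integrands are integrable).
[folklore] -/
theorem integral_duhamel_add {α C : ℝ} {K : ℝ → E →L[ℝ] F}
    (hK : ∀ t, 0 < t → ‖K t‖ ≤ C * t ^ (-α))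
    (hKc : ∀ y : E, ContinuousOn (fun t : ℝ => K t y) (Ioi 0)) (hα : α < 1) {g₁ g₂ : ℝ → E}
    (hg₁ : Continuous g₁) (hg₂ : Continuous g₂) {t : ℝ} (ht : 0 ≤ t) :
    ∫ s in (0 : ℝ)..t, K (t - s) (g₁ s + g₂ s) =
      (∫ s in (0 : ℝ)..t, K (t - s) (g₁ s)) + ∫ s in (0 : ℝ)..t, K (t - s) (g₂ s) := by
  simp only [map_add]
  exact intervalIntegral.integral_add (intervalIntegrable_duhamelIntegrand hK hKc hα hg₁ ht)
    (intervalIntegrable_duhamelIntegrand hK hKc hα hg₂ ht)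

/-- Homogeneity of the Duhamel integral in `g`. [folklore] -/
theorem integral_duhamel_smul (K : ℝ → E →L[ℝ] F) (g : ℝ → E) (c t : ℝ) :
    ∫ s in (0 : ℝ)..t, K (t - s) (c • g s) = c • ∫ s in (0 : ℝ)..t, K (t - s) (g s) := by
  simp only [map_smul, intervalIntegral.integral_smul]

/-! ### The Duhamel operator on `C([0, τ]; E)` -/

/-- **The weakly singular Duhamel operator on `C([0, τ]; E)`** (Pazy 1983, §6.3, proof of Thm 3.1,
the map `F` of (3.7) with the bound (3.9); Henry 1981, Lemma 3.3.2 / proof of Thm 3.3.3).  Let `E` be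
a real Banach space, `τ > 0`, `α < 1`, `C ≥ 0`, and `K : ℝ → L(E)` with `‖K(t)‖ ≤ C t^{-α}` for
`t > 0` and `t ↦ K(t) y` continuous on `(0, ∞)` for every `y`.  Then there is a continuous linear
operator `Φ` on `C([0, τ]; E)` with

  `(Φ G)(t) = ∫₀ᵗ K(t − s) G(s) ds`  (`G` extended to `ℝ` by constants through `Set.projIcc`)

for all `G` and `t ∈ [0, τ]`, and `‖Φ‖ ≤ C τ^{1−α} / (1 − α)`.
[cite: Pazy1983, §6.3, proof of Thm 3.1, (3.7)–(3.9)] -/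
theorem exists_duhamelCLM [CompleteSpace E] {τ α C : ℝ} (hτ : 0 < τ) (hα : α < 1) (hC : 0 ≤ C)
    (K : ℝ → E →L[ℝ] E) (hK : ∀ t, 0 < t → ‖K t‖ ≤ C * t ^ (-α))
    (hKc : ∀ y : E, ContinuousOn (fun t : ℝ => K t y) (Ioi 0)) :
    ∃ Φ : C(Icc (0 : ℝ) τ, E) →L[ℝ] C(Icc (0 : ℝ) τ, E),
      (∀ (G : C(Icc (0 : ℝ) τ, E)) (t : Icc (0 : ℝ) τ),
        Φ G t = ∫ s in (0 : ℝ)..(t : ℝ), K ((t : ℝ) - s) (G (Set.projIcc 0 τ hτ.le s))) ∧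
      ‖Φ‖ ≤ C * τ ^ (1 - α) / (1 - α) := by
  have h1α : 0 < 1 - α := sub_pos.2 hα
  set M := C * τ ^ (1 - α) / (1 - α) with hM
  have hM0 : 0 ≤ M := div_nonneg (mul_nonneg hC (Real.rpow_nonneg hτ.le _)) h1α.le
  have hg : ∀ G : C(Icc (0 : ℝ) τ, E), Continuous fun s : ℝ => G (projIcc 0 τ hτ.le s) :=
    fun G => G.continuous.comp' continuous_projIcc
  have hgb : ∀ (G : C(Icc (0 : ℝ) τ, E)) (s : ℝ), ‖G (projIcc 0 τ hτ.le s)‖ ≤ ‖G‖ :=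
    fun G s => G.norm_coe_le_norm _
  have hΨc : ∀ G : C(Icc (0 : ℝ) τ, E), Continuous fun t : Icc (0 : ℝ) τ =>
      ∫ s in (0 : ℝ)..(t : ℝ), K ((t : ℝ) - s) (G (projIcc 0 τ hτ.le s)) := fun G =>
    (continuousOn_integral_duhamel hK hKc hC hα (hg G) (hgb G)).comp_continuous
      continuous_subtype_val fun t => t.2.1
  set Ψ : C(Icc (0 : ℝ) τ, E) → C(Icc (0 : ℝ) τ, E) := fun G => ⟨_, hΨc G⟩ with hΨdef
  have hΨ : ∀ (G : C(Icc (0 : ℝ) τ, E)) (t : Icc (0 : ℝ) τ),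
      Ψ G t = ∫ s in (0 : ℝ)..(t : ℝ), K ((t : ℝ) - s) (G (projIcc 0 τ hτ.le s)) := fun G t => rfl
  have hΨn : ∀ G : C(Icc (0 : ℝ) τ, E), ‖Ψ G‖ ≤ M * ‖G‖ := fun G => by
    refine (ContinuousMap.norm_le _ (mul_nonneg hM0 (norm_nonneg G))).2 fun t => ?_
    rw [hΨ, hM]
    exact norm_integral_duhamel_le_of_mem_Icc hK hC hα _ (hgb G) t.2
  let L : C(Icc (0 : ℝ) τ, E) →ₗ[ℝ] C(Icc (0 : ℝ) τ, E) :=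
    { toFun := Ψ
      map_add' := fun G₁ G₂ => by
        ext t
        simp only [hΨ, ContinuousMap.add_apply]
        exact integral_duhamel_add hK hKc hα (hg G₁) (hg G₂) t.2.1
      map_smul' := fun c G => by
        ext t
        simp only [hΨ, ContinuousMap.smul_apply, RingHom.id_apply]
        exact integral_duhamel_smul K _ c _ }
  exact ⟨L.mkContinuous M hΨn, fun G t => rfl, L.mkContinuous_norm_le hM0 _⟩

end Literature.Analysis.UnboundedOperators
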